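import Summits.QuantumFields.YangMills.Theorems.BalabanUVNodesN16H7OfReg9
import Summits.QuantumFields.BalabanUV.T4Continuum.Support.NE3EnergyRateFlatClass
import Summits.QuantumFields.BalabanUV.T4Continuum.Support.MinimalActionWitness
import HarnessLib

/-!
# Route «BalabanUVNodes» (K3⁷ `SpineGivenEndpointR13SepCoPH`, stmt-QuantumFields-20544), DAG node N16 = NE3 — CAPTURE, WHERE IT IS FREE:
# (i) the FLAT-DATUM WITNESS — at the datum `1` CAPTURE(ε → ρ) and node N19's value-letter clause hold for EVERY `ρ ≥ 0`, no Theorem 1, no hypothesis;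
# (ii) leaf-06's LEVEL-DEPENDENT class family `thm1Class` — every minimiser of run `k+1` is sup-regular with value letter = ITS class radius from Theorem 1 ALONE (no capture)

Cell `pub-ymgap`, width seat `pub-ymgap-dag-n16-w1` (director-ym №197 ∕ HUMAN RULING D-0149), generation 4, file 8 — the companion of file 7 `…N16InteriorOfCapture` (p606074:
«the interior letter IS capture») and of this seat's LOCATED note `HOME/pub-ymgap-dag-n16-w1/LOCATED-N16-INTERIOR-IS-CAPTURE.md` §4b (evidence on stmt-QuantumFields-20544).
`--kind proof --supports stmt-QuantumFields-20544 --as helper` (count-neutral; proves NO registered stub).  `bears_on: R4∕N16 · junction N16 → N19`.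

THE POINT.  File 7 displays ONE hypothesis — CAPTURE(ε → ρ) on `D` := «every minimiser of every run `k+1` over `sfClass ε` at a datum of `D` lies in `sfClass ρ`» — and shows node N19's
(v′-16) value-letter clause `LeafH3sup … ε b c' …` is EQUIVALENT to it modulo [B11] Theorem 1 (the ⟹ half unconditionally).  This file records, in the kernel, the two situations in
which CAPTURE costs nothing, so that neither the refuters nor the planners re-discover them.  (i) **THE FLAT DATUM** (A6 hygiene WITH content: `capture_self` of file 7 inhabits the
hypothesis only at `ρ = ε`): at the datum `flatCfg = 1` every minimiser `U` of any run over `sfClass ε` has action `A(U) ≤ A(1) = 0` (the flat configuration is admissible,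
`MinimalActionWitness.isMinimiser_sfClass_flatCfg`; actions of `U(N)` configurations are `≥ 0`), hence ZERO CURVATURE on `ℤ^d` (`NE3EnergyRateFlatClass.hol_plaqWord_eq_one_of_levelAction_eq_zero`
— [B7]-side tree facts, no Bałaban estimate), hence `U ∈ sfClass ρ` for EVERY `ρ ≥ 0` (★ `capture_flatCfg`), its flux vanishes and so does the covariant flux gradient, so
`RegularSup d L N ρ c j U` for all `ρ, c ≥ 0` and ★ `leafH3sup_flatCfg : LeafH3sup d L N ε ρ c {flatCfg}` — node N19's clause shape at the flat datum with ANY letters, no Theorem 1,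
no capture hypothesis.  So CAPTURE and the (v′-16) clause are jointly and non-trivially satisfiable (`ρ = 0 < ε`); a refutation of CAPTURE must live at NON-FLAT loose data.
(ii) **THE CAPTURE-FREE CLASS FAMILY** (the second branch of the located fork, note §4b): leaf-06's `MinimalActionDictionary.thm1Class d L N C ε₁ k = sfClass d L N (thm1Radius C ε₁ L k) k`,
`thm1Radius … (k+1) = B₃·levelEps ε₁ L (k+1) = B₃ε₁(1 + s_{k+1})`, runs route (A) with «no uniqueness clause and no minimum over a larger space» (its header; `radius_step` absorbs
[B7] Prop. 1's loss, `MinimalActionFromThm1.upperData_of_thm1At`).  ★ `regularSup_of_isMinimiser_thm1Class`: for `L ≥ 2`, the (9)_{β₀=1} interface and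
`hT : ∀ k, Thm1At C (torusVP d L N G (k+1))` exactly as in files 1–7, `0 < ε₁`, `(7∕3)ε₁ ≤ a₁`, `B₃·(7∕3)ε₁ ≤ 1∕28`, every minimiser of run `k+1` over `thm1Class` at a datum
`V ∈ sfClass ε₁ 0` is `RegularSup d L N r_{k+1} (16937·r_{k+1}) (k+1)` with `r_{k+1} = thm1Radius C ε₁ L (k+1)` — VALUE LETTER = CLASS RADIUS at each level, from Theorem 1 ALONE
(file 1's `leafH3sup_loose_of_thm1At_torusVP` at radius `r_{k+1}` ∘ `isMinimiser_congr`).  What branch (ii) would cost the planners is NOT typed here: the (R2)-type re-key of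
`N16HolderAt` ∕ RR-1's NE3 object ∕ K3⁷'s N16 pin ∕ N19's `sel` class to a level-indexed family, and N21's two-run compatibility.

WHAT THIS FILE PROVES (kernel; theorems only, 0 `def`, 0 sorry; BY NAME over landed modules, none edited).  §1 `levelAction_eq_zero_of_isMinimiser_flatCfg`,
`hol_eq_one_of_isMinimiser_flatCfg`, ★ `capture_flatCfg`, `flux_eq_zero_of_isMinimiser_flatCfg`, `regularSup_of_isMinimiser_flatCfg`, ★ `leafH3sup_flatCfg`.
§2 `thm1Radius_succ_rows`, ★ `regularSup_of_isMinimiser_thm1Class`.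

HONEST FRAMING.  A NON-VACUITY ∕ FEASIBILITY file.  §1 says NOTHING about Bałaban's minimisers at a non-flat datum; §2 is bookkeeping over the displayed `Thm1At` (leaf-06's
instances, divergences D-s3-1…6) and re-keys nothing.  CAPTURE at non-flat loose data (file 7's hypothesis; = Theorem 1's uniqueness content, D-s3-5) remains displayed and UNPROVED.
Nothing of Bałaban asserted or refuted; no stub of K3⁷ closed; N16 ∕ N19 NOT discharged; count-neutral; counts of record unmoved (typed 28∕28 · discharged 5∕27 · A 5∕28); one
finite four-torus at fixed `ε`, Bałaban AS PRINTED — NOT ℝ⁴, NOT infinite volume, NOT OS, NOT a mass gap; the YM mass gap (Clay) is NOT proved by any of this — R4 closes the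
conditional finite-𝕋⁴ rung `BalabanLadder.UV` only.
-/

set_option autoImplicit false

open scoped BigOperators Matrix Matrix.Norms.L2Operator
open NormedSpace

namespace Summit.QuantumFields.YangMills.BalabanUVNodes.N16CaptureWitnesses

open Literature.MathematicalPhysics.QuantumFieldTheory.Balaban1983to89
open B7Prop1Explicit B7Prop2Explicit MatrixLog UnitaryModel
open T4AveragingDeficitWall hiding Site Plane Plaq Bond
open T4AveragingDeficitWallBoundary (IsPeriodicCfg)
open Summit.QuantumFields.BalabanUV.T4Continuum
open AveragingDeficitLatticeH2Prep (fd)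
open MinimalActionLevels (levelAction levelAction_nonneg)
open MinimalActionSandwich (IsMinimiser)
open MinimalActionRate (sfClass)
open MinimalActionRefine (RegularSup)
open MinimalActionDictionary (torusVP RadiiMono sfClass_mono isMinimiser_congr levelEps le_levelEps levelEps_le thm1Radius thm1Class)
open MinimalActionWitness (flatCfg flatCfg_mem_sfClass avgIter_flatCfg levelAction_flatCfg)
open NE3EnergyRateFlatClass (hol_plaqWord_eq_one_of_levelAction_eq_zero)
open NE3.LeafIndexSockets (LeafH3sup)
open B11Thm1 (Thm1At)
open Summit.QuantumFields.YangMills.BalabanUVNodes.N16H7OfReg9 (leafH3sup_loose_of_thm1At_torusVP)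

noncomputable section

variable {d : ℕ} {n : Type} [Fintype n] [DecidableEq n]

/-! ## §1 The flat datum: CAPTURE and the interior leaf for EVERY value letter, unconditionally -/

/-- **A MINIMISER AT THE FLAT DATUM HAS ZERO ACTION** (any run `k`, any class radius `ε ≥ 0`, `L ≥ 1`): the flat configuration is admissible with action `0`
(`MinimalActionWitness.flatCfg_mem_sfClass` ∕ `avgIter_flatCfg` ∕ `levelAction_flatCfg`) and `U(N)` actions are `≥ 0` (`levelAction_nonneg`). [folklore] -/
theorem levelAction_eq_zero_of_isMinimiser_flatCfg [Nonempty n] {L N k : ℕ} (hL : 1 ≤ L) {ε : ℝ} (hε : 0 ≤ ε) {U : Site d → Fin d → (Matrix n n ℂ)ˣ}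
    (hU : IsMinimiser d (sfClass d L N ε) L N k (flatCfg : Site d → Fin d → (Matrix n n ℂ)ˣ) U) : levelAction d L N k U = 0 :=
  le_antisymm (by simpa only [levelAction_flatCfg] using hU.le flatCfg ⟨flatCfg_mem_sfClass L N hε k, avgIter_flatCfg L k⟩)
    (levelAction_nonneg L N k hL hU.mem.1.1)

/-- **… HENCE ZERO CURVATURE ON `ℤ^d`**: every unit plaquette variable of a minimiser at the flat datum is `1` (`L, N ≥ 1`;
`NE3EnergyRateFlatClass.hol_plaqWord_eq_one_of_levelAction_eq_zero` BY NAME). [folklore] -/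
theorem hol_eq_one_of_isMinimiser_flatCfg [Nonempty n] {L N k : ℕ} (hL : 1 ≤ L) (hN : 1 ≤ N) {ε : ℝ} (hε : 0 ≤ ε) {U : Site d → Fin d → (Matrix n n ℂ)ˣ}
    (hU : IsMinimiser d (sfClass d L N ε) L N k (flatCfg : Site d → Fin d → (Matrix n n ℂ)ˣ) U) (x : Site d) (κ μ : Fin d) (hκμ : κ ≠ μ) :
    hol U x (plaqWord κ μ) = 1 :=
  hol_plaqWord_eq_one_of_levelAction_eq_zero hL hN hU.mem.1.1 hU.mem.1.2.1 (levelAction_eq_zero_of_isMinimiser_flatCfg hL hε hU) x κ μ hκμ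

/-- **★ CAPTURE HOLDS AT THE FLAT DATUM FOR EVERY RADIUS `ρ ≥ 0`** (file 7's displayed hypothesis on `D = {flatCfg}`, any class radius `ε ≥ 0`, any run; `L, N ≥ 1`): a minimiser at
the flat datum is unitary, periodic and FLAT, hence in `sfClass ρ` for every `ρ ≥ 0`.  The A6 inhabitant WITH content (`ρ = 0 < ε`); says nothing about non-flat data. [folklore] -/
theorem capture_flatCfg [Nonempty n] {L N : ℕ} (hL : 1 ≤ L) (hN : 1 ≤ N) {ε ρ : ℝ} (hε : 0 ≤ ε) (hρ : 0 ≤ ρ) :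
    ∀ V ∈ ({flatCfg} : Set (Site d → Fin d → (Matrix n n ℂ)ˣ)), ∀ (k : ℕ) (U : Site d → Fin d → (Matrix n n ℂ)ˣ),
      IsMinimiser d (sfClass d L N ε) L N (k + 1) V U → U ∈ sfClass d L N ρ (k + 1) := by
  intro V hV k U hU
  rw [Set.mem_singleton_iff] at hV
  subst hV
  refine ⟨hU.mem.1.1, hU.mem.1.2.1, fun x κ κ' hκ => ?_⟩
  rw [hol_eq_one_of_isMinimiser_flatCfg hL hN hε hU x κ κ' hκ, Units.val_one, sub_self, norm_zero]
  positivity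

/-- The flux of a minimiser at the flat datum vanishes (`F(p) = log U(∂p) = log 1 = 0`). [folklore] -/
theorem flux_eq_zero_of_isMinimiser_flatCfg [Nonempty n] {L N k : ℕ} (hL : 1 ≤ L) (hN : 1 ≤ N) {ε : ℝ} (hε : 0 ≤ ε) {U : Site d → Fin d → (Matrix n n ℂ)ˣ}
    (hU : IsMinimiser d (sfClass d L N ε) L N k (flatCfg : Site d → Fin d → (Matrix n n ℂ)ˣ) U) (p : T4AveragingDeficitWall.Plaq d) : flux U p = 0 := by
  show mlog ((hol U p.1 (plaqWord p.2.1.1 p.2.1.2) : (Matrix n n ℂ)ˣ) : Matrix n n ℂ) = 0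
  rw [hol_eq_one_of_isMinimiser_flatCfg hL hN hε hU p.1 p.2.1.1 p.2.1.2 (ne_of_lt p.2.2), Units.val_one, mlog_one]

/-- **A MINIMISER AT THE FLAT DATUM IS `RegularSup d L N ρ c k` FOR ALL `ρ, c ≥ 0`**: flat (small field of radius `0`) with vanishing flux, hence vanishing covariant flux
gradient. [folklore] -/
theorem regularSup_of_isMinimiser_flatCfg [Nonempty n] {L N k : ℕ} (hL : 1 ≤ L) (hN : 1 ≤ N) {ε ρ c : ℝ} (hε : 0 ≤ ε) (hρ : 0 ≤ ρ) (hc : 0 ≤ c)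
    {U : Site d → Fin d → (Matrix n n ℂ)ˣ} (hU : IsMinimiser d (sfClass d L N ε) L N k (flatCfg : Site d → Fin d → (Matrix n n ℂ)ˣ) U) :
    RegularSup d L N ρ c k U where
  unitary := hU.mem.1.1
  periodic := hU.mem.1.2.1
  small := fun x κ κ' hκ => by
    rw [hol_eq_one_of_isMinimiser_flatCfg hL hN hε hU x κ κ' hκ, Units.val_one, sub_self, norm_zero]
    positivity
  grad := fun x κ π => by
    have h0 : covGrad U (flux U) x κ π = 0 := by
      unfold covGrad Ad
      rw [flux_eq_zero_of_isMinimiser_flatCfg hL hN hε hU, flux_eq_zero_of_isMinimiser_flatCfg hL hN hε hU, mul_zero, zero_mul, sub_zero]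
    rw [h0, norm_zero]
    positivity

/-- **★ NODE N19's VALUE-LETTER CLAUSE AT THE FLAT DATUM, FOR EVERY PAIR OF LETTERS `ρ, c ≥ 0` AND EVERY CLASS RADIUS `ε ≥ 0`** — `LeafH3sup d L N ε ρ c {flatCfg}`, with NO
Theorem 1 and NO capture hypothesis (`L, N ≥ 1`).  Joint non-vacuity of file 7's hypothesis and conclusion at `ρ = 0 < ε`; nothing about non-flat data. [folklore] -/
theorem leafH3sup_flatCfg [Nonempty n] {L N : ℕ} (hL : 1 ≤ L) (hN : 1 ≤ N) {ε ρ c : ℝ} (hε : 0 ≤ ε) (hρ : 0 ≤ ρ) (hc : 0 ≤ c) :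
    LeafH3sup d L N ε ρ c ({flatCfg} : Set (Site d → Fin d → (Matrix n n ℂ)ˣ)) := by
  intro V hV k U hU
  rw [Set.mem_singleton_iff] at hV
  subst hV
  exact regularSup_of_isMinimiser_flatCfg hL hN hε hρ hc hU

/-! ## §2 Leaf-06's level-dependent class family: sup-regularity with value letter = class radius, from Theorem 1 alone -/

/-- The rows of the level-`(k+1)` radius `r_{k+1} = thm1Radius C ε₁ L (k+1) = B₃·levelEps ε₁ L (k+1)` (`L ≥ 2`, `0 < ε₁`, `(7∕3)ε₁ ≤ a₁`, `B₃·(7∕3)ε₁ ≤ 1∕28`):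
`0 < r_{k+1}`, `r_{k+1} ≤ B₃a₁`, `r_{k+1} ≤ 1∕28`, and `r_{k+1}∕B₃ = levelEps ε₁ L (k+1) ≥ ε₁` (leaf-06's `le_levelEps` ∕ `levelEps_le`). [folklore] -/
theorem thm1Radius_succ_rows {L : ℕ} (hL : 2 ≤ L) (C : B11Thm1.Consts) {ε₁ : ℝ} (hε₁ : 0 < ε₁) (ha₁ : 7 / 3 * ε₁ ≤ C.a₁) (h28 : C.B₃ * (7 / 3 * ε₁) ≤ 1 / 28)
    (k : ℕ) :
    0 < thm1Radius C ε₁ L (k + 1) ∧ thm1Radius C ε₁ L (k + 1) ≤ C.B₃ * C.a₁ ∧ thm1Radius C ε₁ L (k + 1) ≤ 1 / 28 ∧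
      thm1Radius C ε₁ L (k + 1) / C.B₃ = levelEps ε₁ L (k + 1) ∧ ε₁ ≤ thm1Radius C ε₁ L (k + 1) / C.B₃ := by
  have hB₃ := C.B₃_pos
  have hr : thm1Radius C ε₁ L (k + 1) = C.B₃ * levelEps ε₁ L (k + 1) := rfl
  have hlo := le_levelEps hL hε₁.le (k + 1)
  have hhi := levelEps_le hL hε₁.le (k + 1)
  have hq : thm1Radius C ε₁ L (k + 1) / C.B₃ = levelEps ε₁ L (k + 1) := by rw [hr, mul_div_cancel_left₀ _ hB₃.ne']
  refine ⟨?_, ?_, ?_, hq, ?_⟩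
  · rw [hr]; exact mul_pos hB₃ (lt_of_lt_of_le hε₁ hlo)
  · rw [hr]; exact mul_le_mul_of_nonneg_left (hhi.trans ha₁) hB₃.le
  · rw [hr]; exact (mul_le_mul_of_nonneg_left hhi hB₃.le).trans h28
  · rw [hq]; exact hlo

/-- **★ THE CAPTURE-FREE SUP-LEAF ON LEAF-06's LEVEL-DEPENDENT FAMILY.**  Let `L ≥ 2`; `G`, `hGm`, `hG`, `C`, `hM`, `hT : ∀ k, Thm1At C (torusVP d L N G (k+1))` exactly as in
files 1–7 ([Balaban1985Variational] Theorem 1 at leaf-06's torus instances, DISPLAYED); `0 < ε₁` with `(7∕3)ε₁ ≤ a₁` and `B₃·(7∕3)ε₁ ≤ 1∕28`.  THEN every minimiser `U` of run `k+1`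
over `thm1Class d L N C ε₁` (`= sfClass (thm1Radius C ε₁ L ·) ·`) at a datum `V ∈ sfClass d L N ε₁ 0` has
`RegularSup d L N (thm1Radius C ε₁ L (k+1)) (16937·thm1Radius C ε₁ L (k+1)) (k+1) U` — value letter = ITS class radius `r_{k+1}`, NO capture: `thm1Class (k+1)` IS print's class (8) at
`ε₁^{(k+1)} = levelEps ε₁ L (k+1)` (`isMinimiser_congr`, `rfl`), the datum is (7)-loose for it (`ε₁ ≤ ε₁^{(k+1)}`), and file 1's `leafH3sup_loose_of_thm1At_torusVP` at radius `r_{k+1}`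
is Theorem 1 (8)–(10) for `U`.  (That the averaged `U` lands in `thm1Class k` is leaf-06's `radius_step` ∕ `upperData_of_thm1At` (H4), not re-derived.) [cite: Balaban1985Variational, Thm 1 (8)–(10) p.279] -/
theorem regularSup_of_isMinimiser_thm1Class [Nonempty n] {L N : ℕ} (hL : 2 ≤ L)
    {G : (Site d → Fin d → (Matrix n n ℂ)ˣ) → Site d → ℕ → ℝ → ℝ → ℝ → Prop} (hGm : RadiiMono d G)
    (hG : ∀ (U : Site d → Fin d → (Matrix n n ℂ)ˣ) (x : Site d) (K : ℕ) (α₀ α₁ α₂ : ℝ), 2 ≤ K → G U x K α₀ α₁ α₂ →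
      ∃ (u : Site d → (Matrix n n ℂ)ˣ) (a : Site d → Fin d → Matrix n n ℂ),
        (∀ z, u z ∈ unitaryUnits (Matrix n n ℂ)) ∧
        (∀ (y : Site d) (τ : Fin d), l1 (y - x) ≤ 2 → ((gaugeAct u U y τ : (Matrix n n ℂ)ˣ) : Matrix n n ℂ) = exp (a y τ)) ∧
        (∀ (y : Site d) (τ : Fin d), l1 (y - x) ≤ 2 → ‖a y τ‖ ≤ α₀) ∧
        (∀ (y : Site d) (τ i : Fin d), l1 (y - x) ≤ 1 → ‖fd i (fun z => a z τ) y‖ ≤ α₁) ∧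
        (∀ (τ i l : Fin d), ‖fd i (fd l (fun z => a z τ)) x‖ ≤ α₂))
    (C : B11Thm1.Consts) (hM : ∀ e : ℝ, 0 < e → e ≤ C.a₁ → 7 / 2 ≤ C.Mfun e)
    (hT : ∀ k : ℕ, Thm1At C (torusVP d L N G (k + 1)))
    {ε₁ : ℝ} (hε₁ : 0 < ε₁) (ha₁ : 7 / 3 * ε₁ ≤ C.a₁) (h28 : C.B₃ * (7 / 3 * ε₁) ≤ 1 / 28)
    {V : Site d → Fin d → (Matrix n n ℂ)ˣ} (hV : V ∈ sfClass d L N ε₁ 0) (k : ℕ) (U : Site d → Fin d → (Matrix n n ℂ)ˣ)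
    (hU : IsMinimiser d (thm1Class d L N C ε₁) L N (k + 1) V U) :
    RegularSup d L N (thm1Radius C ε₁ L (k + 1)) (16937 * thm1Radius C ε₁ L (k + 1)) (k + 1) U := by
  obtain ⟨hr0, hra, hr28, hq, hlo⟩ := thm1Radius_succ_rows hL C hε₁ ha₁ h28 k
  have hL1 : 1 ≤ L := le_trans one_le_two hL
  -- the minimiser over `thm1Class` at run `k+1` IS a minimiser over the class of radius `r_{k+1}` (same set, `rfl`)
  have hU' : IsMinimiser d (sfClass d L N (thm1Radius C ε₁ L (k + 1))) L N (k + 1) V U :=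
    (isMinimiser_congr (𝒞₁ := thm1Class d L N C ε₁) (𝒞₂ := sfClass d L N (thm1Radius C ε₁ L (k + 1))) rfl).1 hU
  -- the datum is (7)-loose for Theorem 1 at `ε₁^{(k+1)} = r_{k+1}/B₃ ≥ ε₁`
  have hVr : V ∈ sfClass d L N (thm1Radius C ε₁ L (k + 1) / C.B₃) 0 := by
    rw [hq]; exact sfClass_mono (by rw [← hq]; exact hlo) hV
  exact leafH3sup_loose_of_thm1At_torusVP hL1 hGm hG C hM hT hr0 hra hr28 (Set.univ : Set (Site d → Fin d → (Matrix n n ℂ)ˣ))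
    V ⟨Set.mem_univ V, hVr⟩ k U hU'

end

end Summit.QuantumFields.YangMills.BalabanUVNodes.N16CaptureWitnesses
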